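import Literature.Combinatorics.AssociationSchemes.JohnsonHarmonics
import Literature.Computability.Complexity.FKNTheorem
import HarnessLib

/-!
# The Friedgut–Kalai–Naor theorem on a slice of the Boolean cube (Filmus 2016)

Source followed: Y. Filmus, *Friedgut–Kalai–Naor theorem for slices of the Boolean cube*, Chicago J.
Theoret. Comput. Sci. 2016, Article 14, 1–17 [Filmus2016FKN] (held: `paper:doi-10-4086-cjtcs-2016-014`,
journal pagination; = arXiv:1410.7834), §2 (definitions, the classical FKN theorem = Thm. 2.1) and §3
(main theorem Thm. 3.1, the uniform biased-cube FKN theorem Thm. 3.3, and the `ε = 0` case Lemma 3.4).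

SETTING (the tree's slice vocabulary, `JohnsonHarmonics`): a point of the cube `{0,1}ⁿ` is a subset
`U : Finset (Fin n)` (`x_i = 1 ↔ i ∈ U`), the slice `C([n],k)` is `slice n k = powersetCard k univ`
[Filmus2016FKN, §2 p. 4: "we can think of `C([n],k)` as the collection of all subsets of `[n]` of size
exactly `k`"], functions are `Finset (Fin n) → ℝ` read on a domain `𝒟 ⊆ 2^{[n]}`, "Boolean" means
`{0,1}`-valued on `𝒟` (`IsBooleanOn`), and "`ε`-close" means `‖f − g‖² = E_𝒟[(f − g)²] ≤ ε` for the uniform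
measure on `𝒟` (`distSq`) [Filmus2016FKN, §2 p. 4]. An affine function is `c₀ + Σ_i c_i x_i`
(`affineFn`; on a slice `c₀` may be absorbed, ibid.), `max_{i ∈ S} x_i` / `min_{i ∈ S} x_i` are `maxFn S` /
`minFn S` with the printed conventions `max ∅ = 0`, `min ∅ = 1`, and `x_i` is `dictFn i`. The degree of a
function on a domain (`HasDegreeLEOn`: it agrees on `𝒟` with a multilinear polynomial `Σ_{|S| ≤ d} v_S x^S`,
i.e. with `zeta v`, `v` supported on sets of size `≤ d` — on `{0,1}ⁿ` every polynomial agrees with a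
multilinear one of no larger degree) and juntas (`IsJuntaOn`: the value on `𝒟` depends on `U ∩ I` only,
`|I| ≤ m`) are the notions of [FilmusIhringer2019, §2]; they are defined here so that the companion file
`SliceKindlerSafra.lean` (Keller–Klein, Filmus–Ihringer, Filmus 2023) shares one vocabulary.

WHAT IS HERE.
* NAMED FACTS (published theorems not proved here, D-0014): `FriedgutKalaiNaor2002_thm` (the classical FKN
  theorem on `{0,1}ⁿ`, in the form [Filmus2016FKN, Thm. 2.1 p. 4]); `Filmus2016_thm31` (FKN on the slice,
  [Filmus2016FKN, Thm. 3.1 p. 5], with the reading `k ≤ n/2 ↦ max`, `k ≥ n/2 ↦ min` of the introduction,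
  p. 3 of the arXiv text); `Filmus2016_thm33` (uniform FKN for `μ_p`, [Filmus2016FKN, Thm. 3.3 p. 5]).
  Unprinted `O(·)` constants are typed as one absolute constant `C` (existentially quantified, outermost).
* PROVED (appended §4): `FriedgutKalaiNaor2002_thm_holds` — the DISCHARGE of the FKN fact, from the
  `±1` Fourier-analytic theorem `Literature.Computability.Complexity.LowDegree.FKN.fkn_pm_one`
  (file `Computability/Complexity/FKNTheorem.lean`, Bonami-lemma proof) by the transport
  `x ↦ {i : x_i = 1}`, with `C = 4000`.
* PROVED: [Filmus2016FKN, Lemma 3.4 p. 6] `Filmus2016_lemma34` — a Boolean affine function on `C([n],k)`,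
  `2 ≤ k ≤ n − 2`, is one of `0, 1, x_i, 1 − x_i` — following the printed proof (minimal coefficient,
  two coefficient classes, the four-element swap); and its corollary [FilmusIhringer2019, Thm. 1.2 p. 3]
  `FilmusIhringer2019_thm12`: a Boolean degree-`1` function on `C([n],k)`, `2 ≤ k ≤ n − 2`, is a `1`-junta.

Consumer: cell pnp-psdrank (summit PneNP), the cut-side structure step ("slice FKN / level-saturation
stability") of the log-scale `r = 1` rung `Literature.Combinatorics.Optimization.RectangleDecayBal` named in
the cell's MEMO-18 §2(g). Label: support / instrument (analysis of Boolean functions on the slice); nothing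
here concerns psd rank or P vs NP. No instances, no notation, standard axioms.

## References
* [Filmus2016FKN] Y. Filmus, Chicago J. Theoret. Comput. Sci. 2016:14 (doi:10.4086/cjtcs.2016.014).
* [FriedgutKalaiNaor2002] E. Friedgut, G. Kalai, A. Naor, *Boolean functions whose Fourier transform is
  concentrated on the first two levels*, Adv. Appl. Math. 29 (2002) 427–437 (the original FKN theorem).
* [FilmusIhringer2019] Y. Filmus, F. Ihringer, *Boolean constant degree functions on the slice are juntas*,
  Discrete Math. 342 (2019) 111614, §2 (degree and juntas on the slice), Thm. 1.2.
-/

noncomputable section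

open Finset
open scoped BigOperators

namespace Literature.Combinatorics.AssociationSchemes

namespace SliceFKN

open JohnsonHarmonics (zeta zeta_apply)

variable {n : ℕ}

/-! ### §2 Vocabulary: slices, Boolean functions, closeness, affine functions, degree, juntas -/

/-- The slice `C([n],k)`: all `k`-element subsets of `[n] = Fin n` (the points of `{0,1}ⁿ` of Hamming
weight `k`, via `x ↦ {i : x_i = 1}`). [cite: Filmus2016FKN, §2 (p. 4)] -/
def slice (n k : ℕ) : Finset (Finset (Fin n)) := powersetCard k univ

/-- Membership in the slice is the cardinality condition. [cite: Filmus2016FKN, §2 (p. 4)] -/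
@[simp] theorem mem_slice {k : ℕ} {U : Finset (Fin n)} : U ∈ slice n k ↔ U.card = k := by
  simp [slice, mem_powersetCard]

/-- `|C([n],k)| = C(n,k)`. [cite: Filmus2016FKN, §2 (p. 4)] -/
theorem card_slice (n k : ℕ) : (slice n k).card = n.choose k := by
  simp [slice, card_powersetCard]

/-- `f` is **Boolean** (`{0,1}`-valued) on the domain `𝒟`. [cite: Filmus2016FKN, §2 (p. 4)] -/
def IsBooleanOn (𝒟 : Finset (Finset (Fin n))) (f : Finset (Fin n) → ℝ) : Prop :=
  ∀ U ∈ 𝒟, f U = 0 ∨ f U = 1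

/-- The squared `L²`-distance `‖f − g‖² = E[(f − g)²]` for the UNIFORM probability measure on the domain `𝒟`
("`f, g` are `ε`-close if `‖f − g‖² ≤ ε`"; for Boolean `f, g` this is `Pr[f ≠ g]`).
[cite: Filmus2016FKN, §2 (p. 4)] -/
def distSq (𝒟 : Finset (Finset (Fin n))) (f g : Finset (Fin n) → ℝ) : ℝ :=
  (∑ U ∈ 𝒟, (f U - g U) ^ 2) / (𝒟.card : ℝ)

/-- The squared `L²(μ_p)`-distance on the whole cube `{0,1}ⁿ` for the product measure
`μ_p(x) = p^{Σ x_i} (1 − p)^{Σ (1 − x_i)}`, i.e. `μ_p(U) = p^{|U|} (1 − p)^{n − |U|}`.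
[cite: Filmus2016FKN, Def. 3.2 (p. 5)] -/
def biasedDistSq (n : ℕ) (p : ℝ) (f g : Finset (Fin n) → ℝ) : ℝ :=
  ∑ U : Finset (Fin n), p ^ U.card * (1 - p) ^ (n - U.card) * (f U - g U) ^ 2

/-- The **affine function** `c₀ + Σ_i c_i x_i`, read on subsets: `U ↦ c₀ + Σ_{i ∈ U} c_i`.
[cite: Filmus2016FKN, §2 (p. 4)] -/
def affineFn (c₀ : ℝ) (c : Fin n → ℝ) : Finset (Fin n) → ℝ := fun U => c₀ + ∑ i ∈ U, c i

/-- `max_{i ∈ S} x_i` (the OR of the coordinates in `S`; `max ∅ = 0`): `1` iff `S ∩ U ≠ ∅`.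
[cite: Filmus2016FKN, §2 (p. 4) and Thm. 3.1 (p. 5)] -/
def maxFn (S : Finset (Fin n)) : Finset (Fin n) → ℝ := fun U => if (S ∩ U).Nonempty then 1 else 0

/-- `min_{i ∈ S} x_i` (the AND of the coordinates in `S`; `min ∅ = 1`): `1` iff `S ⊆ U`.
[cite: Filmus2016FKN, §2 (p. 4) and Thm. 3.1 (p. 5)] -/
def minFn (S : Finset (Fin n)) : Finset (Fin n) → ℝ := fun U => if S ⊆ U then 1 else 0

/-- The dictator `x_i`: `1` iff `i ∈ U`. [cite: Filmus2016FKN, Thm. 2.1 (p. 4)] -/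
def dictFn (i : Fin n) : Finset (Fin n) → ℝ := fun U => if i ∈ U then 1 else 0

/-- `g` has **degree `≤ d` on `𝒟`**: it agrees on `𝒟` with a multilinear polynomial of degree `≤ d`,
`Σ_{|S| ≤ d} v_S x^S`, whose value at the point `U` is `Σ_{S ⊆ U} v_S = zeta v U` ("the degree of a
function on the slice is the minimum degree of a polynomial which agrees with the function on all points
of the slice"; on the slice `C([n],k)`, `k ≤ n/2`, this is the degree of the harmonic representative).
[cite: FilmusIhringer2019, §2 (p. 4)] -/
def HasDegreeLEOn (𝒟 : Finset (Finset (Fin n))) (d : ℕ) (g : Finset (Fin n) → ℝ) : Prop :=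
  ∃ v : Finset (Fin n) → ℝ, (∀ S, d < S.card → v S = 0) ∧ ∀ U ∈ 𝒟, g U = zeta v U

/-- `f` is an **`m`-junta on `𝒟`**: for some set `I` of at most `m` coordinates, the value `f(x)`, `x ∈ 𝒟`,
depends on `x|_I` only ("`f(x) = g(x|_{i_1,…,i_m})`"). [cite: FilmusIhringer2019, §2 (p. 4)] -/
def IsJuntaOn (𝒟 : Finset (Finset (Fin n))) (m : ℕ) (f : Finset (Fin n) → ℝ) : Prop :=
  ∃ I : Finset (Fin n), I.card ≤ m ∧ ∀ U ∈ 𝒟, ∀ V ∈ 𝒟, U ∩ I = V ∩ I → f U = f V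

/-- Unfolding of `affineFn`. [cite: Filmus2016FKN, §2 (p. 4)] -/
@[simp] theorem affineFn_apply (c₀ : ℝ) (c : Fin n → ℝ) (U : Finset (Fin n)) :
    affineFn c₀ c U = c₀ + ∑ i ∈ U, c i := rfl

/-- Unfolding of `dictFn`. [cite: Filmus2016FKN, Thm. 2.1 (p. 4)] -/
@[simp] theorem dictFn_apply (i : Fin n) (U : Finset (Fin n)) :
    dictFn i U = if i ∈ U then 1 else 0 := rfl

/-- `max` over a singleton is the dictator: `maxFn {i} = dictFn i`. [cite: Filmus2016FKN, Thm. 3.1 (p. 5, "|S| ≤ 1")] -/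
theorem maxFn_singleton (i : Fin n) : maxFn ({i} : Finset (Fin n)) = dictFn i := by
  funext U
  have : (({i} : Finset (Fin n)) ∩ U).Nonempty ↔ i ∈ U := by
    rw [singleton_inter]; split_ifs with h <;> simp [h]
  simp only [maxFn, dictFn, this]

/-- `min` over a singleton is the dictator: `minFn {i} = dictFn i`. [cite: Filmus2016FKN, Thm. 3.1 (p. 5, "|S| ≤ 1")] -/
theorem minFn_singleton (i : Fin n) : minFn ({i} : Finset (Fin n)) = dictFn i := by
  funext U; simp [minFn, dictFn]

/-- The printed conventions `max ∅ = 0`, `min ∅ = 1`. [cite: Filmus2016FKN, §2 (p. 4)] -/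
theorem maxFn_empty_minFn_empty : maxFn (∅ : Finset (Fin n)) = 0 ∧ minFn (∅ : Finset (Fin n)) = 1 := by
  constructor <;> funext U <;> simp [maxFn, minFn]

/-- A polynomial supported on sets of size `≤ 1` is affine: `zeta v U = v ∅ + Σ_{i ∈ U} v {i}`.
[cite: FilmusIhringer2019, §2 (p. 4)] -/
theorem zeta_eq_affineFn_of_degree_le_one {v : Finset (Fin n) → ℝ} (hv : ∀ S, 1 < S.card → v S = 0)
    (U : Finset (Fin n)) : zeta v U = affineFn (v ∅) (fun i => v {i}) U := by
  rw [zeta_apply, affineFn_apply, ← Finset.sum_filter_add_sum_filter_not U.powerset (fun T => T.card ≤ 1)]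
  have hzero : ∑ T ∈ U.powerset.filter (fun T => ¬ T.card ≤ 1), v T = 0 :=
    sum_eq_zero fun T hT => hv T (by have := (mem_filter.1 hT).2; omega)
  rw [hzero, add_zero]
  -- the sets of size ≤ 1 inside `U` are `∅` and the singletons
  have hsplit : U.powerset.filter (fun T => T.card ≤ 1) =
      insert ∅ (U.map ⟨fun i => ({i} : Finset (Fin n)), singleton_injective⟩) := by
    ext T
    simp only [mem_filter, mem_powerset, mem_insert, mem_map, Function.Embedding.coeFn_mk]
    constructor
    · rintro ⟨hTU, hT⟩
      rcases Nat.le_one_iff_eq_zero_or_eq_one.1 hT with h0 | h1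
      · exact Or.inl (card_eq_zero.1 h0)
      · obtain ⟨i, rfl⟩ := card_eq_one.1 h1
        exact Or.inr ⟨i, by simpa using hTU, rfl⟩
    · rintro (rfl | ⟨i, hi, rfl⟩)
      · simp
      · simp [hi]
  rw [hsplit, sum_insert (by simp), sum_map]
  simp

/-! ### §2 The classical FKN theorem (named fact) -/

/-- **The Friedgut–Kalai–Naor theorem** (uniform measure on `{0,1}ⁿ`), in the form printed as
[Filmus2016FKN, Thm. 2.1 p. 4]: "Suppose `f : {0,1}ⁿ → {0,1}` is `ε`-close to an affine function. Then `f`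
is `O(ε)`-close to one of the functions `{0, 1, x_1, 1 − x_1, …, x_n, 1 − x_n}`." Typed with one absolute
constant `C` for the `O(·)`; `𝒟 = univ` is the whole cube. Equivalent original form: `‖f − f^{≤1}‖² ≤ ε`
(Fourier weight above level `1`), since `f^{≤1}` is the closest affine function. NAMED FACT;
DISCHARGED below (`FriedgutKalaiNaor2002_thm_holds`, §4, `C = 4000`).
[cite: FriedgutKalaiNaor2002, Thm. 1.1 (p. 428)] [cite: Filmus2016FKN, Thm. 2.1 (p. 4)] -/
def FriedgutKalaiNaor2002_thm : Prop :=
  ∃ C : ℝ, 0 < C ∧ ∀ (n : ℕ) (f : Finset (Fin n) → ℝ) (c₀ : ℝ) (c : Fin n → ℝ) (ε : ℝ),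
    IsBooleanOn univ f → distSq univ f (affineFn c₀ c) ≤ ε →
      distSq univ f 0 ≤ C * ε ∨ distSq univ f 1 ≤ C * ε ∨
        ∃ i : Fin n, distSq univ f (dictFn i) ≤ C * ε ∨ distSq univ f (1 - dictFn i) ≤ C * ε

/-! ### §3 The FKN theorem for the slice and the uniform biased FKN theorem (named facts) -/

/-- **Filmus' FKN theorem for the slice** [Filmus2016FKN, Thm. 3.1 p. 5, verbatim]: "Suppose
`f : C([n],k) → {0,1}` is `ε`-close to an affine function, where `2 ≤ k ≤ n − 2`. Define
`p = min(k/n, 1 − k/n)`. Then either `f` or `1 − f` is `O(ε)`-close to `max_{i ∈ S} x_i` (when `p ≤ 1/2`)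
or to `min_{i ∈ S} x_i` (when `p ≥ 1/2`) for some set `S` of size at most `max(1, O(√ε/p))`." The case
split is by `k/n` (`max` for `k ≤ n/2`, `min` for `k ≥ n/2`), as the introduction states it (arXiv text
p. 3: "`max_{i∈S} x_i` (when `k ≤ n/2`) or `min_{i∈S} x_i` (when `k ≥ n/2`)"); both `O(·)` are typed by
one absolute constant `C`. "It implies that for some constant `C`, if `ε < C p²` then `|S| ≤ 1`, and so `f`
can be approximated by one of `0, 1, x_i, 1 − x_i`" (ibid.). NAMED FACT, not proved here.
[cite: Filmus2016FKN, Thm. 3.1 (p. 5)] -/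
def Filmus2016_thm31 : Prop :=
  ∃ C : ℝ, 0 < C ∧ ∀ (n k : ℕ) (f : Finset (Fin n) → ℝ) (c₀ : ℝ) (c : Fin n → ℝ) (ε : ℝ),
    2 ≤ k → k + 2 ≤ n → IsBooleanOn (slice n k) f → distSq (slice n k) f (affineFn c₀ c) ≤ ε →
      ∃ S : Finset (Fin n),
        (S.card : ℝ) ≤ max 1 (C * Real.sqrt ε / min ((k : ℝ) / n) (1 - (k : ℝ) / n)) ∧
        ((2 * k ≤ n ∧ (distSq (slice n k) f (maxFn S) ≤ C * ε ∨
            distSq (slice n k) (fun U => 1 - f U) (maxFn S) ≤ C * ε)) ∨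
         (n ≤ 2 * k ∧ (distSq (slice n k) f (minFn S) ≤ C * ε ∨
            distSq (slice n k) (fun U => 1 - f U) (minFn S) ≤ C * ε)))

/-- **Uniform FKN theorem for the biased Boolean cube** [Filmus2016FKN, Thm. 3.3 p. 5, verbatim]: "Suppose
`f : {0,1}ⁿ → {0,1}` is `ε`-close to an affine function with respect to the `μ_p` measure, for some
`p ∈ (0,1)`. Then with respect to the `μ_p` measure, either `f` or `1 − f` is `O(ε)`-close to `max_{i ∈ S} x_i`
(when `p ≤ 1/2`) or to `min_{i ∈ S} x_i` (when `p > 1/2`) for some set `S` of size at most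
`max(1, O(√ε / min(p, 1 − p)))`." (Kindler–Safra's biased FKN theorem has a `p`-dependent constant and
closeness to a dictatorship; here the constant is uniform in `p`.) NAMED FACT, not proved here.
[cite: Filmus2016FKN, Thm. 3.3 (p. 5)] -/
def Filmus2016_thm33 : Prop :=
  ∃ C : ℝ, 0 < C ∧ ∀ (n : ℕ) (p : ℝ) (f : Finset (Fin n) → ℝ) (c₀ : ℝ) (c : Fin n → ℝ) (ε : ℝ),
    0 < p → p < 1 → IsBooleanOn univ f → biasedDistSq n p f (affineFn c₀ c) ≤ ε →
      ∃ S : Finset (Fin n),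
        (S.card : ℝ) ≤ max 1 (C * Real.sqrt ε / min p (1 - p)) ∧
        ((p ≤ 1 / 2 ∧ (biasedDistSq n p f (maxFn S) ≤ C * ε ∨
            biasedDistSq n p (fun U => 1 - f U) (maxFn S) ≤ C * ε)) ∨
         (1 / 2 < p ∧ (biasedDistSq n p f (minFn S) ≤ C * ε ∨
            biasedDistSq n p (fun U => 1 - f U) (minFn S) ≤ C * ε)))

/-! ### §3.2 The case `ε = 0` (proved): Boolean affine functions on a slice are dictators -/

/-- A `k`-subset of `[n]` containing a given set `A` and avoiding a given set `B` exists as soon as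
`|A| ≤ k` and `k + |B| ≤ n` (`A`, `B` disjoint). [cite: Filmus2016FKN, Lemma 3.4 (p. 6, proof: "let S be some set containing 1 but not i")] -/
theorem exists_mem_slice_superset_disjoint {k : ℕ} (A B : Finset (Fin n)) (hAB : Disjoint A B)
    (hA : A.card ≤ k) (hB : k + B.card ≤ n) :
    ∃ U ∈ slice n k, A ⊆ U ∧ Disjoint U B := by
  -- choose `k − |A|` further elements outside `A ∪ B`
  have hcard : k - A.card ≤ ((A ∪ B)ᶜ).card := by
    rw [card_compl, Fintype.card_fin, card_union_of_disjoint hAB]; omega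
  obtain ⟨T, hTsub, hTcard⟩ := exists_subset_card_eq hcard
  refine ⟨A ∪ T, ?_, subset_union_left, ?_⟩
  · rw [mem_slice, card_union_of_disjoint, hTcard]
    · omega
    · exact disjoint_left.2 fun i hiA hiT => by
        have := mem_compl.1 (hTsub hiT); exact this (mem_union_left _ hiA)
  · refine disjoint_left.2 fun i hi hiB => ?_
    rcases mem_union.1 hi with hiA | hiT
    · exact disjoint_left.1 hAB hiA hiB
    · exact mem_compl.1 (hTsub hiT) (mem_union_right _ hiB)

/-- Swapping a set `A ⊆ U` against a set `B` disjoint from `U` of the same size stays in the slice and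
changes an affine function by `Σ_B c − Σ_A c`.
[cite: Filmus2016FKN, Lemma 3.4 (p. 6, proof: "f(S △ {1,i}) − f(S) = c_i − c_1")] -/
theorem affineFn_swap (c₀ : ℝ) (c : Fin n → ℝ) {U A B : Finset (Fin n)} (hA : A ⊆ U)
    (hB : Disjoint U B) :
    affineFn c₀ c ((U \ A) ∪ B) = affineFn c₀ c U - ∑ i ∈ A, c i + ∑ i ∈ B, c i := by
  simp only [affineFn_apply]
  rw [sum_union (disjoint_of_subset_left sdiff_subset hB), sum_sdiff_eq_sub hA]
  ring

/-- Cardinality of the swapped set. [cite: Filmus2016FKN, Lemma 3.4 (p. 6, proof)] -/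
theorem card_swap {U A B : Finset (Fin n)} (hA : A ⊆ U) (hB : Disjoint U B) (hAB : A.card = B.card) :
    ((U \ A) ∪ B).card = U.card := by
  rw [card_union_of_disjoint (disjoint_of_subset_left sdiff_subset hB), card_sdiff_of_subset hA]
  have := card_le_card hA
  omega

/-- A difference of two values in `{0,1}` lies in `{−1, 0, 1}`; in particular it is `≤ 1`.
[cite: Filmus2016FKN, Lemma 3.4 (p. 6, proof)] -/
theorem sub_le_one_of_boolean {a b : ℝ} (ha : a = 0 ∨ a = 1) (hb : b = 0 ∨ b = 1) : a - b ≤ 1 := by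
  rcases ha with rfl | rfl <;> rcases hb with rfl | rfl <;> norm_num

/-- **[Filmus2016FKN, Lemma 3.4] (the case `ε = 0` of the slice FKN theorem), PROVED**: "Suppose
`f : C([n],k) → {0,1}` is affine, where `2 ≤ k ≤ n − 2`. Then `f ∈ {0, 1}` or `f ∈ {x_i, 1 − x_i}` for some
`i`." Typed for a function `f` that agrees with `c₀ + Σ_{i ∈ U} c_i` on the slice. The proof is the printed
one: take a coordinate `i₀` with minimal coefficient; a swap `i₀ ↔ j` changes `f` by `c_j − c_{i₀} ∈ {0,1}`,
so the coefficients take two values `c_{i₀}, c_{i₀} + 1`; if both classes had two elements, a double swap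
would change `f` by `2`; a singleton class gives `x_i` or `1 − x_i`, an empty upper class a constant.
[cite: Filmus2016FKN, Lemma 3.4 (p. 6)] -/
theorem Filmus2016_lemma34 {k : ℕ} (hk : 2 ≤ k) (hkn : k + 2 ≤ n) (f : Finset (Fin n) → ℝ) (c₀ : ℝ)
    (c : Fin n → ℝ) (hf : ∀ U ∈ slice n k, f U = affineFn c₀ c U) (hB : IsBooleanOn (slice n k) f) :
    (∀ U ∈ slice n k, f U = 0) ∨ (∀ U ∈ slice n k, f U = 1) ∨
      ∃ i : Fin n, (∀ U ∈ slice n k, f U = dictFn i U) ∨ (∀ U ∈ slice n k, f U = 1 - dictFn i U) := by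
  classical
  have hn : 0 < n := by omega
  haveI : Nonempty (Fin n) := ⟨⟨0, hn⟩⟩
  -- Boolean values of the affine function on the slice
  have hBa : ∀ U ∈ slice n k, affineFn c₀ c U = 0 ∨ affineFn c₀ c U = 1 := fun U hU => by
    rw [← hf U hU]; exact hB U hU
  -- a coordinate with minimal coefficient
  obtain ⟨i₀, -, hi₀⟩ := exists_min_image univ c univ_nonempty
  have hmin : ∀ j, c i₀ ≤ c j := fun j => hi₀ j (mem_univ j)
  -- Step 1: every coefficient is `c i₀` or `c i₀ + 1`
  have hstep : ∀ j, c j = c i₀ ∨ c j = c i₀ + 1 := by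
    intro j
    by_cases hj : j = i₀
    · exact Or.inl (by rw [hj])
    obtain ⟨U, hU, hAU, hUB⟩ := exists_mem_slice_superset_disjoint (k := k) {i₀} {j}
      (disjoint_singleton.2 (Ne.symm hj)) (by simp; omega) (by simp; omega)
    have hU' : (U \ {i₀}) ∪ {j} ∈ slice n k := by
      rw [mem_slice, card_swap hAU hUB (by simp), mem_slice.1 hU]
    have hval := affineFn_swap c₀ c hAU hUB
    simp only [sum_singleton] at hval
    -- `f(U') − f(U) = c j − c i₀ ≥ 0` and `f(U'), f(U) ∈ {0,1}`
    have hvals : c j - c i₀ = affineFn c₀ c ((U \ {i₀}) ∪ {j}) - affineFn c₀ c U := by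
      rw [hval]; ring
    rcases hBa _ hU' with h' | h' <;> rcases hBa _ hU with h | h <;> rw [h', h] at hvals
    · left; linarith
    · exfalso; linarith [hmin j]
    · right; linarith
    · left; linarith
  -- the upper class
  set I₁ : Finset (Fin n) := univ.filter (fun j => c j = c i₀ + 1) with hI₁_def
  set I₀ : Finset (Fin n) := univ.filter (fun j => c j = c i₀) with hI₀_def
  have hi₀I₀ : i₀ ∈ I₀ := by simp [hI₀_def]
  have hmemI : ∀ j, j ∈ I₀ ∨ j ∈ I₁ := fun j => by
    rcases hstep j with h | h
    · exact Or.inl (by simp [hI₀_def, h])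
    · exact Or.inr (by simp [hI₁_def, h])
  have hI₀val : ∀ j ∈ I₀, c j = c i₀ := fun j hj => by simpa [hI₀_def] using hj
  have hI₁val : ∀ j ∈ I₁, c j = c i₀ + 1 := fun j hj => by simpa [hI₁_def] using hj
  have hdisj : Disjoint I₀ I₁ := disjoint_left.2 fun j h0 h1 => by
    have := hI₀val j h0; have := hI₁val j h1; linarith
  -- value of the affine function on a `k`-set: `c₀ + k c_{i₀} + |U ∩ I₁|`
  have hformula : ∀ U ∈ slice n k,
      affineFn c₀ c U = c₀ + k * c i₀ + ((U ∩ I₁).card : ℝ) := by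
    intro U hU
    rw [affineFn_apply]
    have hsplit : ∑ i ∈ U, c i = ∑ i ∈ U, (c i₀ + if i ∈ I₁ then 1 else 0) := by
      refine sum_congr rfl fun i hi => ?_
      rcases hmemI i with h | h
      · rw [hI₀val i h, if_neg (disjoint_left.1 hdisj h)]; ring
      · rw [hI₁val i h, if_pos h]
    rw [hsplit, sum_add_distrib, sum_const, mem_slice.1 hU, nsmul_eq_mul, ← sum_filter, filter_mem_eq_inter]
    simp only [sum_const, nsmul_eq_mul, mul_one]
    ring
  -- Case analysis on the sizes of the two classes
  by_cases hI₁0 : I₁ = ∅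
  · -- all coefficients equal: `f` is constant on the slice, hence `0` or `1`
    have hconst : ∀ U ∈ slice n k, f U = c₀ + k * c i₀ := fun U hU => by
      rw [hf U hU, hformula U hU, hI₁0]; simp
    -- the slice is nonempty
    obtain ⟨U₀, hU₀, -, -⟩ := exists_mem_slice_superset_disjoint (k := k) (∅ : Finset (Fin n)) ∅
      (disjoint_empty_right _) (by simp) (by simp; omega)
    rcases hB U₀ hU₀ with h | h
    · left; intro U hU; rw [hconst U hU, ← hconst U₀ hU₀, h]
    · right; left; intro U hU; rw [hconst U hU, ← hconst U₀ hU₀, h]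
  by_cases hI₁1 : I₁.card = 1
  · -- `I₁ = {j}`: `f = A + x_j`, and Booleanity forces `A = 0`
    obtain ⟨j, hj⟩ := card_eq_one.1 hI₁1
    have hval : ∀ U ∈ slice n k, f U = c₀ + k * c i₀ + dictFn j U := fun U hU => by
      rw [hf U hU, hformula U hU, hj, dictFn_apply]
      by_cases hjU : j ∈ U
      · rw [inter_singleton_of_mem hjU, if_pos hjU]; simp
      · rw [inter_singleton_of_notMem hjU, if_neg hjU]; simp
    -- a set avoiding `j` and a set containing `j`
    obtain ⟨U₀, hU₀, -, hU₀j⟩ := exists_mem_slice_superset_disjoint (k := k) (∅ : Finset (Fin n)) {j}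
      (disjoint_empty_left _) (by simp) (by simp; omega)
    obtain ⟨U₁, hU₁, hU₁j, -⟩ := exists_mem_slice_superset_disjoint (k := k) ({j} : Finset (Fin n)) ∅
      (disjoint_empty_right _) (by simp; omega) (by simp; omega)
    have hj0 : j ∉ U₀ := fun h => disjoint_left.1 hU₀j h (mem_singleton_self j)
    have hj1 : j ∈ U₁ := hU₁j (mem_singleton_self j)
    have e0 := hval U₀ hU₀; rw [dictFn_apply, if_neg hj0] at e0
    have e1 := hval U₁ hU₁; rw [dictFn_apply, if_pos hj1] at e1
    have hA : c₀ + k * c i₀ = 0 := by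
      rcases hB U₀ hU₀ with h | h <;> rcases hB U₁ hU₁ with h' | h' <;> linarith
    right; right; exact ⟨j, Or.inl fun U hU => by rw [hval U hU, hA, zero_add]⟩
  by_cases hI₀1 : I₀.card = 1
  · -- `I₀ = {i₀}`: `f = B − x_{i₀}`, and Booleanity forces `B = 1`
    have hI₀eq : I₀ = {i₀} := by
      obtain ⟨a, ha⟩ := card_eq_one.1 hI₀1
      rw [ha] at hi₀I₀ ⊢; rw [mem_singleton.1 hi₀I₀]
    have hI₁eq : ∀ U : Finset (Fin n), U ∩ I₁ = U \ {i₀} := by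
      intro U; ext x
      simp only [mem_inter, mem_sdiff, mem_singleton]
      constructor
      · rintro ⟨hxU, hx1⟩
        exact ⟨hxU, fun h => disjoint_left.1 hdisj (h ▸ hi₀I₀) hx1⟩
      · rintro ⟨hxU, hx⟩
        refine ⟨hxU, ?_⟩
        rcases hmemI x with h | h
        · exact absurd (by rw [hI₀eq] at h; exact mem_singleton.1 h) hx
        · exact h
    have hval : ∀ U ∈ slice n k, f U = (c₀ + k * c i₀ + k) - dictFn i₀ U := fun U hU => by
      rw [hf U hU, hformula U hU, hI₁eq, dictFn_apply]
      by_cases hiU : i₀ ∈ U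
      · rw [card_sdiff_of_subset (singleton_subset_iff.2 hiU), card_singleton, mem_slice.1 hU, if_pos hiU,
          Nat.cast_sub (by have := mem_slice.1 hU; omega)]
        simp only [Nat.cast_one]
        ring
      · rw [sdiff_singleton_eq_erase, erase_eq_of_notMem hiU, mem_slice.1 hU, if_neg hiU]; ring
    obtain ⟨U₀, hU₀, -, hU₀j⟩ := exists_mem_slice_superset_disjoint (k := k) (∅ : Finset (Fin n)) {i₀}
      (disjoint_empty_left _) (by simp) (by simp; omega)
    obtain ⟨U₁, hU₁, hU₁j, -⟩ := exists_mem_slice_superset_disjoint (k := k) ({i₀} : Finset (Fin n)) ∅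
      (disjoint_empty_right _) (by simp; omega) (by simp; omega)
    have hj0 : i₀ ∉ U₀ := fun h => disjoint_left.1 hU₀j h (mem_singleton_self _)
    have hj1 : i₀ ∈ U₁ := hU₁j (mem_singleton_self _)
    have e0 := hval U₀ hU₀; rw [dictFn_apply, if_neg hj0] at e0
    have e1 := hval U₁ hU₁; rw [dictFn_apply, if_pos hj1] at e1
    have hBv : c₀ + k * c i₀ + k = 1 := by
      rcases hB U₀ hU₀ with h | h <;> rcases hB U₁ hU₁ with h' | h' <;> linarith
    right; right; exact ⟨i₀, Or.inr fun U hU => by rw [hval U hU, hBv]⟩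
  -- Otherwise both classes have `≥ 2` elements: a double swap changes `f` by `2`, contradiction
  exfalso
  have hI₁2 : 1 < I₁.card := by
    have : I₁.card ≠ 0 := fun h => hI₁0 (card_eq_zero.1 h)
    omega
  have hI₀2 : 1 < I₀.card := by
    have : I₀.card ≠ 0 := fun h => by rw [card_eq_zero.1 h] at hi₀I₀; simp at hi₀I₀
    omega
  obtain ⟨A, hA, hAcard⟩ := exists_subset_card_eq (show 2 ≤ I₀.card from hI₀2)
  obtain ⟨B, hBsub, hBcard⟩ := exists_subset_card_eq (show 2 ≤ I₁.card from hI₁2)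
  have hABd : Disjoint A B := disjoint_of_subset_left hA (disjoint_of_subset_right hBsub hdisj)
  obtain ⟨U, hU, hAU, hUB⟩ := exists_mem_slice_superset_disjoint (k := k) A B hABd (by omega) (by omega)
  have hU' : (U \ A) ∪ B ∈ slice n k := by
    rw [mem_slice, card_swap hAU hUB (by rw [hAcard, hBcard]), mem_slice.1 hU]
  have hval := affineFn_swap c₀ c hAU hUB
  have hsumA : ∑ i ∈ A, c i = 2 * c i₀ := by
    rw [sum_congr rfl fun i hi => hI₀val i (hA hi), sum_const, hAcard, nsmul_eq_mul]; norm_num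
  have hsumB : ∑ i ∈ B, c i = 2 * (c i₀ + 1) := by
    rw [sum_congr rfl fun i hi => hI₁val i (hBsub hi), sum_const, hBcard, nsmul_eq_mul]; norm_num
  rw [hsumA, hsumB] at hval
  have h2 : affineFn c₀ c ((U \ A) ∪ B) - affineFn c₀ c U = 2 := by rw [hval]; ring
  have := sub_le_one_of_boolean (hBa _ hU') (hBa _ hU)
  linarith

/-- **[FilmusIhringer2019, Thm. 1.2] (folklore; Filmus–Ihringer), PROVED**: "If `2 ≤ k ≤ n − 2` and
`f : C([n],k) → {0,1}` has degree `1`, then `f` depends on at most one coordinate." A degree-`≤ 1`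
function is affine (`zeta_eq_affineFn_of_degree_le_one`), so `Filmus2016_lemma34` applies and each of
`0, 1, x_i, 1 − x_i` is a `1`-junta. [cite: FilmusIhringer2019, Thm. 1.2 (p. 3)] -/
theorem FilmusIhringer2019_thm12 {k : ℕ} (hk : 2 ≤ k) (hkn : k + 2 ≤ n) (f : Finset (Fin n) → ℝ)
    (hdeg : HasDegreeLEOn (slice n k) 1 f) (hB : IsBooleanOn (slice n k) f) :
    IsJuntaOn (slice n k) 1 f := by
  obtain ⟨v, hv, hfv⟩ := hdeg
  have hf : ∀ U ∈ slice n k, f U = affineFn (v ∅) (fun i => v {i}) U := fun U hU => by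
    rw [hfv U hU, zeta_eq_affineFn_of_degree_le_one hv]
  rcases Filmus2016_lemma34 hk hkn f _ _ hf hB with h0 | h1 | ⟨i, hi | hi⟩
  · exact ⟨∅, by simp, fun U hU V hV _ => by rw [h0 U hU, h0 V hV]⟩
  · exact ⟨∅, by simp, fun U hU V hV _ => by rw [h1 U hU, h1 V hV]⟩
  · refine ⟨{i}, by simp, fun U hU V hV hUV => ?_⟩
    rw [hi U hU, hi V hV, dictFn_apply, dictFn_apply]
    have : (i ∈ U) ↔ (i ∈ V) := by
      constructor <;> intro h
      · have : i ∈ U ∩ {i} := mem_inter.2 ⟨h, mem_singleton_self i⟩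
        rw [hUV] at this; exact (mem_inter.1 this).1
      · have : i ∈ V ∩ {i} := mem_inter.2 ⟨h, mem_singleton_self i⟩
        rw [← hUV] at this; exact (mem_inter.1 this).1
    simp [this]
  · refine ⟨{i}, by simp, fun U hU V hV hUV => ?_⟩
    rw [hi U hU, hi V hV, dictFn_apply, dictFn_apply]
    have : (i ∈ U) ↔ (i ∈ V) := by
      constructor <;> intro h
      · have : i ∈ U ∩ {i} := mem_inter.2 ⟨h, mem_singleton_self i⟩
        rw [hUV] at this; exact (mem_inter.1 this).1
      · have : i ∈ V ∩ {i} := mem_inter.2 ⟨h, mem_singleton_self i⟩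
        rw [← hUV] at this; exact (mem_inter.1 this).1
    simp [this]


/-! ### §4 Discharge of `FriedgutKalaiNaor2002_thm` (appended 2026-08-28; the `±1` Fourier-analytic
core is `Literature.Computability.Complexity.LowDegree.FKN.fkn_pm_one`, file
`Computability/Complexity/FKNTheorem.lean`). Points of the cube `x : Fin n → Bool` correspond to the
subsets `{i : x_i = 1} = univ.filter (x · = true)` (as in `SliceLevelInequality.lean` §4). -/

section Discharge

open Literature.Computability.Complexity.LowDegree (IsLevelLE isLevelLE_const isLevelLE_walsh)
open Literature.Computability.Complexity.LowDegree.FKN (highWeight highWeight_le_mean_sq_sub fkn_pm_one)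
open Literature.Probability.RandomGraphs.LowDegree (walsh sgn sgn_true sgn_false)

/-- Sums over the cube `{0,1}ⁿ` are sums over subsets of `[n]` (`x ↦ {i : x_i = 1}` is a bijection).
[cite: Filmus2016FKN, §2 (p. 4, "(x_1,…,x_n) ↦ {i ∈ [n] : x_i = 1}")] -/
theorem sum_cube_eq_sum_finset (φ : Finset (Fin n) → ℝ) :
    ∑ x : Fin n → Bool, φ (univ.filter fun i => x i = true) = ∑ U : Finset (Fin n), φ U := by
  let e : (Fin n → Bool) ≃ Finset (Fin n) :=
    { toFun := fun x => univ.filter fun i => x i = true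
      invFun := fun U i => decide (i ∈ U)
      left_inv := fun x => funext fun i => by simp
      right_inv := fun U => Finset.ext fun i => by simp }
  exact Fintype.sum_equiv e _ _ fun _ => rfl

/-- `|P([n])| = 2ⁿ`. [cite: Filmus2016FKN, §2 (p. 4)] -/
theorem card_univ_finset_fin : (((univ : Finset (Finset (Fin n))).card : ℕ) : ℝ) = 2 ^ n := by
  rw [Finset.card_univ, Fintype.card_finset, Fintype.card_fin]; push_cast; rfl

/-- An affine function of the set of `1`-coordinates is a level-`≤ 1` function on the cube:
`2(c₀ + Σ_{i : x_i = 1} c_i) − 1 = (2c₀ − 1 + Σ_i c_i) − Σ_i c_i χ_{i}(x)` (`𝟙[x_i] = (1 − χ_{i}(x))/2`).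
[cite: Filmus2016FKN, §2 (p. 4)] -/
theorem two_mul_affineFn_filter_sub_one (c₀ : ℝ) (c : Fin n → ℝ) (x : Fin n → Bool) :
    2 * affineFn c₀ c (univ.filter fun i => x i = true) - 1 =
      (2 * c₀ - 1 + ∑ i, c i) - ∑ i, c i * walsh {i} x := by
  rw [affineFn_apply, sum_filter]
  have hw : ∀ i : Fin n, walsh ({i} : Finset (Fin n)) x = sgn (x i) := fun i => by simp [walsh]
  have hi : ∀ i : Fin n, (if x i = true then c i else 0) = c i * ((1 - sgn (x i)) / 2) := fun i => by
    cases x i <;> simp [sgn]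
  simp_rw [hi, hw]
  rw [show ∑ i, c i * ((1 - sgn (x i)) / 2) = (∑ i, c i) / 2 - (∑ i, c i * sgn (x i)) / 2 by
    rw [sum_div, sum_div, ← sum_sub_distrib]; exact sum_congr rfl fun i _ => by ring]
  ring

/-- **Discharge of the named fact `FriedgutKalaiNaor2002_thm` (the Friedgut–Kalai–Naor theorem), with
`C = 4000`.** Proof: pass to `F = 2f − 1 : {0,1}ⁿ → {±1}` along `x ↦ {i : x_i = 1}`; an affine function
of the subset is a level-`≤ 1` function, so `η(F) ≤ E[(F − ℓ)²] = 4 · distSq ≤ 4ε`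
(`FKN.highWeight_le_mean_sq_sub`); `FKN.fkn_pm_one` gives `s χ_S` (`|S| ≤ 1`, `s = ±1`) with
`E[(F − s χ_S)²] ≤ 4000 η(F) ≤ 16000 ε`, i.e. `distSq univ f ((1 + s χ_S)/2) ≤ 4000 ε`, and `(1 + s χ_S)/2`
read on subsets is one of `0, 1, x_i, 1 − x_i`. [cite: FriedgutKalaiNaor2002, Thm. 1.1 (p. 428)] -/
theorem FriedgutKalaiNaor2002_thm_holds : FriedgutKalaiNaor2002_thm := by
  refine ⟨4000, by norm_num, ?_⟩
  intro n f c₀ c ε hB hdist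
  classical
  -- the `±1` function on the cube
  set F : (Fin n → Bool) → ℝ := fun x => 2 * f (univ.filter fun i => x i = true) - 1 with hF_def
  have hF : ∀ x, F x = 1 ∨ F x = -1 := fun x => by
    rcases hB (univ.filter fun i => x i = true) (mem_univ _) with h | h
    · right; rw [hF_def]; simp only [h]; norm_num
    · left; rw [hF_def]; simp only [h]; norm_num
  -- the affine function is level ≤ 1 on the cube
  set ℓ : (Fin n → Bool) → ℝ := fun x => 2 * affineFn c₀ c (univ.filter fun i => x i = true) - 1
    with hℓ_def
  have hℓ : IsLevelLE 1 ℓ := by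
    have : ℓ = fun x => (2 * c₀ - 1 + ∑ i, c i) - ∑ i, c i * walsh {i} x := by
      funext x; exact two_mul_affineFn_filter_sub_one c₀ c x
    rw [this]
    exact (isLevelLE_const _ 1).sub
      (Literature.Computability.Complexity.LowDegree.IsLevelLE.sum univ fun i _ =>
        (isLevelLE_walsh {i} (by simp)).const_mul (c i))
  -- `E[(F − ℓ)²] = 4 · distSq ≤ 4ε`, hence `η(F) ≤ 4ε`
  have hdist' : (∑ x, (F x - ℓ x) ^ 2) / 2 ^ n = 4 * distSq univ f (affineFn c₀ c) := by
    have e : ∀ x, (F x - ℓ x) ^ 2 =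
        4 * (f (univ.filter fun i => x i = true) - affineFn c₀ c (univ.filter fun i => x i = true)) ^ 2 :=
      fun x => by rw [hF_def, hℓ_def]; ring
    simp_rw [e]
    rw [← mul_sum, sum_cube_eq_sum_finset (fun U => (f U - affineFn c₀ c U) ^ 2), distSq,
      card_univ_finset_fin]
    ring
  have hη : highWeight F ≤ 4 * ε :=
    (highWeight_le_mean_sq_sub (F := F) hℓ).trans (by rw [hdist']; linarith)
  -- apply the `±1` theorem and translate back
  obtain ⟨s, S, hs, hScard, hclose⟩ := fkn_pm_one F hF
  have hclose' : (∑ x, (F x - s * walsh S x) ^ 2) / 2 ^ n ≤ 16000 * ε := by linarith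
  set g : Finset (Fin n) → ℝ := fun U => (1 + s * walsh S (fun i => decide (i ∈ U))) / 2 with hg_def
  have hback : distSq univ f g ≤ 4000 * ε := by
    have e : ∀ x : Fin n → Bool, (F x - s * walsh S x) ^ 2 =
        4 * (f (univ.filter fun i => x i = true) - g (univ.filter fun i => x i = true)) ^ 2 := fun x => by
      have hx : (fun i => decide (i ∈ univ.filter fun j => x j = true)) = x := funext fun i => by simp
      rw [hF_def, hg_def]; simp only [hx]; ring
    simp_rw [e] at hclose'
    rw [← mul_sum, sum_cube_eq_sum_finset (fun U => (f U - g U) ^ 2), mul_div_assoc] at hclose'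
    rw [distSq, card_univ_finset_fin]
    linarith
  -- `(1 + s χ_S)/2` is one of `0, 1, x_i, 1 − x_i`
  have hS : S = ∅ ∨ ∃ i, S = {i} := by
    rcases Nat.le_one_iff_eq_zero_or_eq_one.1 hScard with h0 | h1
    · exact Or.inl (card_eq_zero.1 h0)
    · obtain ⟨i, hi⟩ := card_eq_one.1 h1; exact Or.inr ⟨i, hi⟩
  rcases hS with rfl | ⟨i, rfl⟩
  · rcases hs with rfl | rfl
    · right; left
      have : g = 1 := by funext U; rw [hg_def]; simp
      rwa [this] at hback
    · left
      have : g = 0 := by funext U; rw [hg_def]; simp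
      rwa [this] at hback
  · right; right; refine ⟨i, ?_⟩
    have hw : ∀ U : Finset (Fin n),
        walsh ({i} : Finset (Fin n)) (fun j => decide (j ∈ U)) = if i ∈ U then -1 else 1 := by
      intro U
      rw [show walsh ({i} : Finset (Fin n)) (fun j => decide (j ∈ U)) = sgn (decide (i ∈ U)) by
        simp [walsh]]
      by_cases hi : i ∈ U <;> simp [hi]
    rcases hs with rfl | rfl
    · right
      have : g = 1 - dictFn i := by
        funext U
        simp only [hg_def, hw U, Pi.sub_apply, Pi.one_apply, dictFn_apply]
        split_ifs <;> norm_num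
      rwa [this] at hback
    · left
      have : g = dictFn i := by
        funext U
        simp only [hg_def, hw U, dictFn_apply]
        split_ifs <;> norm_num
      rwa [this] at hback

end Discharge

end SliceFKN

end Literature.Combinatorics.AssociationSchemes
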